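import Mathlib
import HarnessLib
import Literature.Analysis.FluidPDE.VorticityCalculus
import Literature.Analysis.FluidPDE.EulerTimeScaling
import Summits.NavierStokesRegularity.NavierStokesRegularity.Theorems.UnthreadedDoorAntidynamoWallOneInstantAxisymmetric
import Summits.NavierStokesRegularity.NavierStokesRegularity.Theorems.SymmetryModuliCountAxisymEndLiouvilleStubAxisNormalForm

/-!
# Route `UnthreadedDoor` / `ThreadingFlux`, crux `PoloidalLiouville` (stmt-NavierStokesRegularity-1222), antidynamo v2 skeleton (sha16 `4ebf5683127b`),
# WALL `stub_scalarLiouville`: ONE INSTANT OF INFINITESIMAL VORTICITY SYMMETRY CLOSES THE WALL — the frame-covariant form of rigidity (R)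

Support file (seat leafhand-ns-unthreadeddoor-3 g14, cell decomp-ns), `--supports stmt-NavierStokesRegularity-1222 --as helper`; theorems only.

The window-rigidity crux ⟨27585⟩ `UnthreadedRigidity` outputs an INFINITESIMAL symmetry `D(u t)(x)[A(x − x₀)] = A (u t x)` of the VELOCITY in a fixed
(Oseen-mild, inertial) frame, and reaches ⟨1222⟩ only on the inertial stratum (`FrameSlot.constant_of_unthreadedRigidity_of_affineGauge`, p833594; residual =
an accelerating Oseen gauge, p833693).  The VORTICITY is blind to the Galilean frame slot (`curl (w(· − A(t)) + c(t)) = (curl w)(· − A(t))`), so the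
frame-covariant currency is an infinitesimal symmetry of `curl v` about an axis through ANY centre.  This file shows that ONE INSTANT of it closes the wall:

* ★★ `FrameSlot.constant_of_fderiv_curl_skew_slice` — UNCONDITIONAL: a flow of the wall's class (bounded ancient duality-mild, measurable slices, jointly
  smooth, vorticity tangent to the spheres about `x₀`) whose vorticity at ONE `t₁ < 0` satisfies `D(curl v(t₁))(x)[A(x − x₁)] = A (curl v(t₁) x)` for all
  `x`, for SOME skew `A ≠ 0` and SOME centre `x₁` (not necessarily `x₀`), has spatially constant slices.  [the `AxisymEndLiouville` line's
  `exists_conj_eq_smul_rotGen` / `fderiv_normalised_rotGen` / `isAxisymmetric_of_fderiv_rotGen` straighten `A` and integrate the symmetry of `curl v(t₁)`; by `CellFlux.curl_conjAxis` the straightened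
  vorticity `curl (conjAxis L x₁ (v t₁))` is `det L •` that field, still `IsAxisymmetric`; then `OneInstant.constant_of_curl_axisymmetric_slice` (axis
  pinning, no swirl on the axis, KNSS transfer).]
* ★ `FrameSlot.poloidalLiouville_of_vorticityRigidity` — BY NAME: the crux `PoloidalLiouville` (its exact binders) FOLLOWS from
  **(R_ω) ONE-INSTANT VORTICITY RIGIDITY** «every flow of the wall's class is irrotational at all negative times, or at SOME instant its vorticity is
  infinitesimally axisymmetric about SOME axis» — a hypothesis immune to the Galilean frame slot (it transports verbatim to the Oseen-gauge representative
  with its moving centre), hence the honest research target behind both ⟨1222⟩ and the drift-class form of ⟨27585⟩.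

HONEST LABEL: the first theorem is an unconditional one-instant closer (assembly over landed theorems); the second is a by-name reduction to (R_ω), which is
OPEN in print (it contains KNSS 2009 Thm 5.2's hypothesis as the integrated, all-time, swirl-free case); nothing here proves `stub_scalarLiouville`,
`PoloidalLiouville` (1222), `UnthreadedRigidity` (27585), or bears on Navier–Stokes regularity; no summit statement is proved. [folklore]
[cite: KochNadirashviliSereginSverak2009, Lemma 3.1, §4, Thm 5.2 (arXiv:0709.3599 pp. 7–10); MajdaBertozziCUP2002, §1.2, §2.3.3; LemarieRieusset2016, Thm. 9.12]
-/

noncomputable section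

-- the summit and its single sub-problem share the name (CONVENTIONS §1)
set_option linter.dupNamespace false

open scoped Topology InnerProductSpace RealInnerProductSpace ContDiff
open Filter Set Function Metric MeasureTheory
open Literature.Analysis Literature.Analysis.FluidPDE

namespace Summit.NavierStokesRegularity.NavierStokesRegularity.Theorems.PoloidalLiouville.Antidynamo

open Summit.NavierStokesRegularity.NavierStokesRegularity.Theorems.PoloidalLiouville (constantOfIrrotational)
open Summit.NavierStokesRegularity.NavierStokesRegularity.Theorems.PoloidalLiouville.NetFlux (E3)
open Summit.NavierStokesRegularity.NavierStokesRegularity.Theorems.PoloidalLiouville.CellFlux (conjAxis conjAxis_apply)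
open Summit.NavierStokesRegularity.NavierStokesRegularity.Theorems.AxisymEndLiouville.AbsorbingAxisSwirlExtinction
  (exists_conj_eq_smul_rotGen fderiv_normalised_rotGen isAxisymmetric_of_fderiv_rotGen)

namespace FrameSlot

/-- ★★ **ONE INSTANT OF INFINITESIMAL AXISYMMETRY OF THE VORTICITY ⇒ CONSTANT SLICES** (unconditional).  Let `v` be a bounded ancient mild solution
(`ν = 1`, duality class) with measurable slices, jointly smooth on `(−∞,0) × ℝ³`, whose vorticity is tangent to the spheres about `x₀` at all times.  If
for ONE `t₁ < 0` there are a centre `x₁` and a skew linear `A ≠ 0` (`⟪A x, x⟫ = 0`) with `D(curl v(t₁))(x)[A (x − x₁)] − A (curl v(t₁) x) = 0` for all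
`x`, then every slice of `v` is spatially constant.
[cite: KochNadirashviliSereginSverak2009, Lemma 3.1, Thm 5.2 (arXiv:0709.3599 pp. 7–10); MajdaBertozziCUP2002, §2.3.3] -/
theorem constant_of_fderiv_curl_skew_slice
    (v : ℝ → EuclideanSpace ℝ (Fin 3) → EuclideanSpace ℝ (Fin 3)) (x₀ : EuclideanSpace ℝ (Fin 3))
    (hB : Literature.Analysis.FluidPDE.IsBoundedAncientMildSolution 1 v)
    (hm : ∀ t < 0, AEStronglyMeasurable (v t) volume)
    (hsm : ContDiffOn ℝ (⊤ : ℕ∞) (Function.uncurry v) (Set.Iio 0 ×ˢ Set.univ))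
    (hun : ∀ t < 0, ∀ x, ⟪x - x₀, curl (v t) x⟫ = 0)
    (h₁ : ∃ t₁ < 0, ∃ (x₁ : EuclideanSpace ℝ (Fin 3)) (A : EuclideanSpace ℝ (Fin 3) →L[ℝ] EuclideanSpace ℝ (Fin 3)),
      (∀ x, ⟪A x, x⟫ = 0) ∧ A ≠ 0 ∧ ∀ x, fderiv ℝ (curl (v t₁)) x (A (x - x₁)) - A (curl (v t₁) x) = 0) :
    ∀ t < 0, ∃ b : EuclideanSpace ℝ (Fin 3), ∀ x, v t x = b := by
  obtain ⟨t₁, ht₁, x₁, A, hskew, hA0, hsym⟩ := h₁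
  have hsm' : IsSmoothSpaceTimeOn (Iio 0) v := hsm
  have hvt : ContDiff ℝ (⊤ : ℕ∞) (v t₁) := hsm'.contDiff_slice ht₁
  have hv2 : ContDiff ℝ ((1 : ℕ∞) + 1) (v t₁) := hvt.of_le (by norm_cast)
  have hc1 : ContDiff ℝ (1 : ℕ∞) (curl (v t₁)) := contDiff_curl hv2
  have hdiff : Differentiable ℝ (curl (v t₁)) := hc1.differentiable (by simp)
  -- straighten the generator (`L A L⁻¹ = α J`) and integrate the symmetry of the vorticity slice (the `AxisymEndLiouville` line's
  -- `exists_conj_eq_smul_rotGen` / `fderiv_normalised_rotGen` / `isAxisymmetric_of_fderiv_rotGen`, composed for the slice `curl v(t₁)`)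
  obtain ⟨L, α, hα, hconj⟩ := exists_conj_eq_smul_rotGen hskew hA0
  have hL : Differentiable ℝ (fun y : E3 => L y) := by
    simpa using L.toContinuousLinearEquiv.differentiable
  have hLs : Differentiable ℝ (fun y : E3 => L.symm y) := by
    simpa using L.symm.toContinuousLinearEquiv.differentiable
  have hd : Differentiable ℝ (fun z => L (curl (v t₁) (L.symm z + x₁))) :=
    hL.comp (hdiff.comp (hLs.add_const x₁))
  have hax : IsAxisymmetric (fun z => L (curl (v t₁) (L.symm z + x₁))) :=
    isAxisymmetric_of_fderiv_rotGen hd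
      (fderiv_normalised_rotGen hdiff L hα hconj x₁ fun x => sub_eq_zero.1 (hsym x))
  -- the straightened vorticity of the slice is `det L •` the integrated field
  have hkey : curl (conjAxis L x₁ (v t₁)) =
      fun z => (L : EuclideanSpace ℝ (Fin 3) →L[ℝ] EuclideanSpace ℝ (Fin 3)).det • L (curl (v t₁) (L.symm z + x₁)) :=
    funext fun z => CellFlux.curl_conjAxis L x₁ (v t₁) z
  have haxc : IsAxisymmetric (curl (conjAxis L x₁ (v t₁))) := by
    rw [hkey]
    exact hax.const_smul _
  exact OneInstant.constant_of_curl_axisymmetric_slice v x₀ hB hm hsm hun ⟨t₁, ht₁, L, x₁, haxc⟩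

/-- **… and the vorticity conclusion** (the wall's currency). [cite: KochNadirashviliSereginSverak2009, Thm 5.2 (arXiv:0709.3599 pp. 9–10)] -/
theorem curl_eq_zero_of_fderiv_curl_skew_slice
    (v : ℝ → EuclideanSpace ℝ (Fin 3) → EuclideanSpace ℝ (Fin 3)) (x₀ : EuclideanSpace ℝ (Fin 3))
    (hB : Literature.Analysis.FluidPDE.IsBoundedAncientMildSolution 1 v)
    (hm : ∀ t < 0, AEStronglyMeasurable (v t) volume)
    (hsm : ContDiffOn ℝ (⊤ : ℕ∞) (Function.uncurry v) (Set.Iio 0 ×ˢ Set.univ))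
    (hun : ∀ t < 0, ∀ x, ⟪x - x₀, curl (v t) x⟫ = 0)
    (h₁ : ∃ t₁ < 0, ∃ (x₁ : EuclideanSpace ℝ (Fin 3)) (A : EuclideanSpace ℝ (Fin 3) →L[ℝ] EuclideanSpace ℝ (Fin 3)),
      (∀ x, ⟪A x, x⟫ = 0) ∧ A ≠ 0 ∧ ∀ x, fderiv ℝ (curl (v t₁)) x (A (x - x₁)) - A (curl (v t₁) x) = 0) :
    ∀ t < 0, ∀ x, curl (v t) x = 0 := by
  intro t ht x
  obtain ⟨b, hb⟩ := constant_of_fderiv_curl_skew_slice v x₀ hB hm hsm hun h₁ t ht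
  have hvt : v t = fun _ => b := funext hb
  rw [hvt, curl_eq_curlCLM, fderiv_const_apply, map_zero]

/-- ★ **THE CRUX BELOW (R_ω) ONE-INSTANT VORTICITY RIGIDITY, BY NAME.**  If every flow of the wall's class (bounded ancient duality-mild, measurable slices,
jointly smooth, vorticity tangent to the spheres about some `x₀`) is EITHER irrotational at all negative times OR has, at SOME instant `t₁ < 0`, a vorticity
slice infinitesimally axisymmetric about SOME axis (`∃ x₁`, skew `A ≠ 0`, `D(curl v(t₁))(x)[A(x − x₁)] = A (curl v(t₁) x)`), then `PoloidalLiouville`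
(stmt-1222; conclusion in the crux's exact binder order).  (R_ω) is frame-covariant — unlike the velocity-level, fixed-frame ⟨27585⟩ — and is the honest
research statement behind the wall; OPEN in print. [cite: KochNadirashviliSereginSverak2009, §4, Thm 5.2 (arXiv:0709.3599 pp. 8–10); LemarieRieusset2016, Thm. 9.12] -/
theorem poloidalLiouville_of_vorticityRigidity
    (hVR : ∀ (v : ℝ → EuclideanSpace ℝ (Fin 3) → EuclideanSpace ℝ (Fin 3)) (x₀ : EuclideanSpace ℝ (Fin 3)),
      Literature.Analysis.FluidPDE.IsBoundedAncientMildSolution 1 v →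
      (∀ t < 0, AEStronglyMeasurable (v t) volume) →
      ContDiffOn ℝ (⊤ : ℕ∞) (Function.uncurry v) (Set.Iio 0 ×ˢ Set.univ) →
      (∀ t < 0, ∀ x, ⟪x - x₀, curl (v t) x⟫ = 0) →
      (∀ t < 0, ∀ x, curl (v t) x = 0) ∨
        ∃ t₁ < 0, ∃ (x₁ : EuclideanSpace ℝ (Fin 3)) (A : EuclideanSpace ℝ (Fin 3) →L[ℝ] EuclideanSpace ℝ (Fin 3)),
          (∀ x, ⟪A x, x⟫ = 0) ∧ A ≠ 0 ∧ ∀ x, fderiv ℝ (curl (v t₁)) x (A (x - x₁)) - A (curl (v t₁) x) = 0) :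
    ∀ v : ℝ → EuclideanSpace ℝ (Fin 3) → EuclideanSpace ℝ (Fin 3),
      Literature.Analysis.FluidPDE.IsBoundedAncientMildSolution 1 v →
      (∀ t < 0, AEStronglyMeasurable (v t) volume) →
      ContDiffOn ℝ (⊤ : ℕ∞) (Function.uncurry v) (Set.Iio 0 ×ˢ Set.univ) →
      (∃ x₀ : EuclideanSpace ℝ (Fin 3), ∀ t < 0, ∀ x,
        inner ℝ (x - x₀) (Literature.Analysis.FluidPDE.curl (v t) x) = 0) →
      ∀ t < 0, ∃ b : EuclideanSpace ℝ (Fin 3), ∀ x, v t x = b := by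
  intro v hB hm hsm hx₀
  obtain ⟨x₀, hun⟩ := hx₀
  rcases hVR v x₀ hB hm hsm hun with h0 | h1
  · exact constantOfIrrotational v hB hsm h0
  · exact constant_of_fderiv_curl_skew_slice v x₀ hB hm hsm hun h1

end FrameSlot

end Summit.NavierStokesRegularity.NavierStokesRegularity.Theorems.PoloidalLiouville.Antidynamo

end
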